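import Literature.NumberTheory.ModularForms.SiegelCuspFormsHalfIntegralWeight
import Literature.NumberTheory.ModularForms.SiegelModularFormsHalfIntegralWeightDegreeOneEquiv
import HarnessLib

/-!
# Degree one: A–Z's cusp-forms `𝔑_{k/2}(Γ₀¹(N), [χ])` ((3.67) with `ξ = M̂ ∈ 𝔊`) ARE Shimura's `S_{k/2}(N, χ)` (`4 ∣ N`)

Layer `Literature/NumberTheory/ModularForms`, namespace `Literature.NumberTheory.ModularForms.SiegelModularForm` (lane
`lit-hodgefound`, Layer A2, seat `lit-hodgefound-skel-2`, row A2-309; on A2-306 `SiegelCuspFormsHalfIntegralWeight` ((3.67) at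
`w = k/2`: `IsSiegelCuspFormHalfLevel`, the space `halfLevelCuspSpace` — `F|Φ_ξ = (F|_{k/2}ξ)|Φ = 0` for every `ξ ∈ 𝔊` over `Γⁿ`),
A2-308 `SiegelModularFormsHalfIntegralWeightDegreeOneEquiv` (`𝔐_{k/2}(Γ₀¹(N), [χ]) ≃ₗ M_{k/2}(N, χ)`, `powEightModularForm :
f⁸ ∈ M_{4k}(Γ₁(N))`), A2-302 `SiegelCoveringGroup` ((3.46) `norm_siegelSlashHat_sq : |F|_{k/2}ξ|² = |F²|_k P(ξ)|`,
`SymplecticCover.exists_val_eq`), A2-285 `SiegelCuspFormsLevelDegreeOne` (the integral-weight twin: in degree one `(F|_kγ)|Φ` is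
Mathlib's value of `f ∣[k] γ` at `i∞`), p16 (`tendsto_ofComplex_I_mul_atImInfty`, `blockDiag1_fin_zero`), and the lane's Shimura
files (`halfIntCuspForms k N χ = S_{k/2}(N, χ)`: `f(gz)²/(cz + d)^k → 0` at `i∞` for every `g ∈ SL₂(ℤ)`)). One linear equivalence
(`halfLevelCuspSpaceShimuraEquiv`), theorems; no named fact, no instance.

THE POINT. A–Z's cusp condition (3.67) in degree `1` asks, for every `ξ ∈ 𝔊` over `M ∈ Γ¹ = SL₂(ℤ)`, that the Siegel operator
kill `F|_{k/2}ξ`, i.e. [Ch. 2 §3.4 (3.51) (p0077)] `lim_{λ → +∞} (F|_{k/2}ξ)(iλ) = 0` — a limit along ONE ray; Shimura's asks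
`f|[ξ]_k → 0` at `i∞` uniformly, i.e. (squared) `f(gz)²/(cz + d)^k → 0` as `Im z → ∞`. By (3.46) `|(F|_{k/2}ξ)((z))|² =
|f(gz)²/(cz + d)^k|` (`norm_siegelSlashHat_one1_sq`), so Shimura ⟹ A–Z is immediate; for A–Z ⟹ Shimura the translate
`(f⁸)|_{4k} g = (f(gz)²/(cz + d)^k)⁴` of the Mathlib modular form `f⁸ ∈ M_{4k}(Γ₁(N))` (A2-308) is `h`-periodic, holomorphic and
bounded at `i∞`, hence HAS a limit at `i∞` (its value at the cusp `g·∞`, «`(f[α]_k)(τ) = Σ_{n ≥ 0} a_n q_hⁿ`»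
[DiamondShurman2005, §1.2 (p. 18)]), which the ray detects (`isZeroAtImInfty_slashSq_iff_tendsto_ray`).

## What is here

* §1 Shimura's side: `tendsto_slashSq_pow_four_atImInfty` (`(f(gz)²/(cz + d)^k)⁴` has a limit at `i∞`),
  **`isZeroAtImInfty_slashSq_iff_tendsto_ray`** (`f(gz)²/(cz + d)^k → 0` at `i∞` iff it `→ 0` along `z = iλ`, `λ → +∞`).
* §2 (3.46) in degree one: **`norm_siegelSlashHat_one1_sq`**: `|(F|_{k/2}ξ)((τ))|² = |F((gτ))²/(cτ + d)^k| = ‖slashSq k (τ ↦ F((τ))) g τ‖`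
  for `ξ ∈ 𝔊` over `g`.
* §3 **`toUHPFun_mem_halfIntCuspForms_of_mem_halfLevelCuspSpace`** (`𝔑 → S`), `toUHPFun_indicator_ofUHPFun_fun`,
  **`indicator_ofUHPFun_mem_halfLevelCuspSpace`** (`S → 𝔑`), **`IsSiegelCuspFormHalfLevel.toUHPFun_mem_halfIntCuspForms`**,
  **`isSiegelCuspFormHalfLevel_ofUHPFun_of_mem`** ((3.67) ⟺ Shimura's cusp condition).
* §4 **`halfLevelCuspSpaceShimuraEquiv k N χ hN : halfLevelCuspSpace (siegelGamma0 1 N) k [χ] ≃ₗ[ℂ] halfIntCuspForms k N χ`**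
  (the restriction of A2-308's `halfLevelSpaceShimuraEquiv`), `halfLevelCuspSpaceShimuraEquiv_apply`,
  `coe_halfLevelCuspSpaceShimuraEquiv_symm_apply`, `coe_halfLevelCuspSpaceShimuraEquiv_eq`, `finrank_halfLevelCuspSpace_gamma0_one_eq`.

## References

* [AndrianovZhuravlev2015] A. N. Andrianov, V. G. Zhuravlev, *Modular Forms and Hecke Operators*, Transl. Math. Monogr.
  145, AMS, Ch. 2 §3.3 (3.21), (3.46) (p0070, p0075); §3.4 (3.50)–(3.51) (p0077); §3.5 (3.67) («ξ = M̂ ∈ 𝔊 with P(M̂) ∈ Γⁿ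
  if w = k/2») (p0079); Ch. 1 §4.5 Proposition 4.15 (p0046).
* [Shimura1973HalfIntegral] G. Shimura, *On modular forms of half integral weight*, Ann. of Math. 97 (1973) 440–481, §1
  (`S_k(N, χ)`, the cusp conditions through `f|[ξ]_k`, `ξ` over `SL₂(ℤ)`).
* [DiamondShurman2005] F. Diamond, J. Shurman, *A First Course in Modular Forms*, GTM 228, §1.2 (p. 18), Definition 1.2.3.
-/

noncomputable section

open Complex Real Matrix Set Filter Topology
open scoped MatrixGroups Manifold ModularForm UpperHalfPlane

namespace Literature.NumberTheory.ModularForms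

namespace SiegelModularForm

open Literature.NumberTheory.Automorphic (siegelUpperHalfSpace)
open Literature.NumberTheory.ModularForms.SiegelUpperHalfSpace
open Literature.NumberTheory.EllipticCurves.ModularForms
open CongruenceSubgroup ModularForm

/-! ### §1 Shimura's side: `f(gz)²/(cz + d)^k` has a limit at `i∞`; vanishing along the ray `iλ` suffices -/

section Shimura

variable {k N : ℕ} [NeZero N] {χ : DirichletCharacter ℂ N} {f : ℍ → ℂ}

/-- From `‖u‖ⁿ → 0` to `u → 0`. [folklore] -/
private theorem tendsto_zero_of_norm_pow_tendsto_zero {α E : Type*} [SeminormedAddCommGroup E] {l : Filter α} {u : α → E}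
    {n : ℕ} (h : Tendsto (fun x => ‖u x‖ ^ n) l (𝓝 0)) : Tendsto u l (𝓝 0) := by
  rw [NormedAddGroup.tendsto_nhds_zero] at h ⊢
  intro ε hε
  filter_upwards [h (ε ^ n) (pow_pos hε n)] with x hx
  rw [Real.norm_of_nonneg (pow_nonneg (norm_nonneg _) n)] at hx
  exact lt_of_pow_lt_pow_left₀ n hε.le hx

/-- `(f⁸)|_{4k} g = (slashSq k f g)⁴` (see A2-308). [folklore] -/
private theorem slash_pow_eight_eq (k : ℕ) (f : ℍ → ℂ) (g : SL(2, ℤ)) :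
    (fun z : ℍ => f z ^ 8) ∣[((4 * k : ℕ) : ℤ)] g = fun z => slashSq k f g z ^ 4 := by
  funext z
  rw [SL_slash_apply, slashSq, div_pow, ← pow_mul, _root_.zpow_neg, zpow_natCast, div_eq_mul_inv, ← pow_mul,
    show k * 4 = 4 * k by ring]

/-- **`(f(gz)²/(cz + d)^k)⁴ = (f⁸)|_{4k} g` has a limit at `i∞`** (`f ∈ M_{k/2}(N, χ)`, `4 ∣ N`, `g ∈ SL₂(ℤ)`): the translate of
the modular form `f⁸ ∈ M_{4k}(Γ₁(N))` (A2-308) by `g` is `h`-periodic, holomorphic and bounded at `i∞`, so its `q_h`-function is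
analytic at `0` and the limit is Mathlib's `valueAtInfty`. [cite: DiamondShurman2005, §1.2 (p. 18) ("(f[α]_k)(τ) = Σ_{n≥0} a_n q_{h}ⁿ")] [cite: Shimura1973HalfIntegral, §1] -/
theorem tendsto_slashSq_pow_four_atImInfty (hN : 4 ∣ N) (hf : f ∈ halfIntModularForms k N χ) (g : SL(2, ℤ)) :
    Tendsto (fun z : ℍ => slashSq k f g z ^ 4) UpperHalfPlane.atImInfty
      (𝓝 (UpperHalfPlane.valueAtInfty (fun z : ℍ => slashSq k f g z ^ 4))) := by
  set F8 : ModularForm (Gamma1 N) ((4 * k : ℕ) : ℤ) := powEightModularForm hN hf with hF8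
  have hcoe : (fun z : ℍ => slashSq k f g z ^ 4) = (⇑F8 ∣[((4 * k : ℕ) : ℤ)] g) := by
    rw [hF8, coe_powEightModularForm, slash_pow_eight_eq]
  obtain ⟨h, hpos, hmem⟩ := exists_pos_conj_T_pow_mem (Gamma1 N) g
  have hh : (0 : ℝ) < h := Nat.cast_pos.2 hpos
  have hper : Function.Periodic ((⇑F8 ∣[((4 * k : ℕ) : ℤ)] g) ∘ UpperHalfPlane.ofComplex) (h : ℝ) := by
    have hp := SlashInvariantFormClass.periodic_comp_ofComplex
      (f := SlashInvariantForm.translate F8 (g : GL (Fin 2) ℝ)) (natCast_mem_strictPeriods_conj hmem)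
    rw [SlashInvariantForm.coe_translate] at hp
    exact hp
  have hhol : MDiff (⇑F8 ∣[((4 * k : ℕ) : ℤ)] g) := (ModularFormClass.holo F8).slash _ (g : GL (Fin 2) ℝ)
  have hbdd : UpperHalfPlane.IsBoundedAtImInfty (⇑F8 ∣[((4 * k : ℕ) : ℤ)] g) := ModularFormClass.bdd_at_infty_slash F8 g
  have han := UpperHalfPlane.analyticAt_cuspFunction_zero hh hper hhol hbdd
  have hcomp : (UpperHalfPlane.cuspFunction h (⇑F8 ∣[((4 * k : ℕ) : ℤ)] g) ∘
      fun τ : ℍ => Function.Periodic.qParam h (τ : ℂ)) = ⇑F8 ∣[((4 * k : ℕ) : ℤ)] g := by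
    funext τ
    exact UpperHalfPlane.eq_cuspFunction τ hh.ne' hper
  have h3 := han.continuousAt.tendsto.comp (UpperHalfPlane.qParam_tendsto_atImInfty hh)
  rw [hcomp, UpperHalfPlane.cuspFunction_apply_zero hh han hper] at h3
  rw [hcoe]
  exact h3

/-- **Vanishing at the cusp `g·∞` is detected along the ray**: for `f ∈ M_{k/2}(N, χ)` (`4 ∣ N`) and `g ∈ SL₂(ℤ)`,
`f(gz)²/(cz + d)^k → 0` as `Im z → ∞` iff `→ 0` along `z = iλ`, `λ → +∞` (the limit at `i∞` exists by
`tendsto_slashSq_pow_four_atImInfty`, and the ray tends to `i∞`). [cite: AndrianovZhuravlev2015, Ch. 2 §3.4 (3.51) ("F|Φ = lim_{λ→+∞} F(iλ)") (p0077); §3.5 (3.67) (p0079)] [cite: DiamondShurman2005, Definition 1.2.3 (4)] -/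
theorem isZeroAtImInfty_slashSq_iff_tendsto_ray (hN : 4 ∣ N) (hf : f ∈ halfIntModularForms k N χ) (g : SL(2, ℤ)) :
    UpperHalfPlane.IsZeroAtImInfty (slashSq k f g) ↔
      Tendsto (fun t : ℝ => slashSq k f g (UpperHalfPlane.ofComplex (I * t))) atTop (𝓝 0) := by
  constructor
  · intro h
    exact (h : Tendsto (slashSq k f g) UpperHalfPlane.atImInfty (𝓝 0)).comp tendsto_ofComplex_I_mul_atImInfty
  · intro h
    have h4 := tendsto_slashSq_pow_four_atImInfty hN hf g
    have hray4 := h4.comp tendsto_ofComplex_I_mul_atImInfty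
    have hray0 : Tendsto (fun t : ℝ => slashSq k f g (UpperHalfPlane.ofComplex (I * t)) ^ 4) atTop (𝓝 0) := by
      simpa using h.pow 4
    have hc : UpperHalfPlane.valueAtInfty (fun z : ℍ => slashSq k f g z ^ 4) = 0 := tendsto_nhds_unique hray4 hray0
    rw [hc] at h4
    have hn : Tendsto (fun z : ℍ => ‖slashSq k f g z‖ ^ 4) UpperHalfPlane.atImInfty (𝓝 0) := by
      have := tendsto_zero_iff_norm_tendsto_zero.1 h4
      simpa only [norm_pow] using this
    exact tendsto_zero_of_norm_pow_tendsto_zero hn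

end Shimura

/-! ### §2 (3.46) in degree one: `|(F|_{k/2}ξ)((τ))|² = |F((gτ))²/(cτ + d)^k|` -/

section NormSq

variable {k : ℕ} {F : Matrix (Fin 1) (Fin 1) ℂ → ℂ}

/-- **(3.46) in degree one**: for `ξ ∈ 𝔊` over `g ∈ SL₂(ℤ) = Γ¹`, `|(F|_{k/2}ξ)((τ))|² = |(cτ + d)^{−k} F((gτ))²| =
‖slashSq k (τ ↦ F((τ))) g τ‖` (`|φ(Z)|² = |det(CZ + D)|`). [cite: AndrianovZhuravlev2015, Ch. 2 §3.3 (3.46), (3.14), (3.21) (p0069–p0075)] [cite: Shimura1973HalfIntegral, §1] -/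
theorem norm_siegelSlashHat_one1_sq {ξ : SymplecticCover 1} {g : SL(2, ℤ)}
    (hξ : ξ.val = symplecticIntHom 1 (symplecticGroupFinOneEquiv.symm g)) (τ : ℍ) :
    ‖siegelSlashHat (k : ℤ) ξ F (one1 (τ : ℂ))‖ ^ 2 = ‖slashSq k (toUHPFun F) g τ‖ := by
  rw [norm_siegelSlashHat_sq ξ F (one1_coe_mem τ), SymplecticCover.cmat_eq_of_val_eq hξ, coe_symplecticGroupFinOneEquiv_symm,
    siegelSlash_apply, moeb_spOfSL, det_denom_spOfSL, norm_slashSq, Pi.pow_apply, zpow_natCast, norm_mul, norm_inv, norm_pow,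
    norm_pow, ← toUHPFun_apply F, div_eq_inv_mul]

end NormSq

/-! ### §3 `𝔑_{k/2}(Γ₀¹(N), [χ]) ↔ S_{k/2}(N, χ)` -/

section Cusp

variable {N : ℕ} [NeZero N] {k : ℕ} (χ : DirichletCharacter ℂ N) {F : Matrix (Fin 1) (Fin 1) ℂ → ℂ} {f : ℍ → ℂ}

/-- **`𝔑 → S`: `F ∈ 𝔑_{k/2}(Γ₀¹(N), [χ])` (`4 ∣ N`) ⟹ `(τ ↦ F((τ))) ∈ S_{k/2}(N, χ) = halfIntCuspForms k N χ`.** For `g ∈ SL₂(ℤ)`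
take any `ξ ∈ 𝔊` over `g` (`SymplecticCover.exists_val_eq`); (3.67) gives `(F|_{k/2}ξ)(iλ) → 0`, i.e. (§2) `f(gz)²/(cz + d)^k → 0`
along the ray, hence (§1) at `i∞`. [cite: AndrianovZhuravlev2015, Ch. 2 §3.5 (3.67) (p0079); §3.4 (3.51) (p0077)] [cite: Shimura1973HalfIntegral, §1 (S_k(N, χ))] -/
theorem toUHPFun_mem_halfIntCuspForms_of_mem_halfLevelCuspSpace (hN : 4 ∣ N)
    (hF : F ∈ halfLevelCuspSpace (siegelGamma0 1 N) (k : ℤ) (gamma0DirichletChar 1 N χ)) :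
    toUHPFun F ∈ halfIntCuspForms k N χ := by
  have hM := (isSiegelModularFormHalfLevel_of_mem_halfLevelSpace hF.1).toUHPFun_mem_halfIntModularForms χ hN
  refine mem_halfIntCuspForms_iff.2 ⟨hM.1, hM.2.1, fun g => ?_⟩
  obtain ⟨ξ, hξ, -⟩ := SymplecticCover.exists_val_eq (symplecticIntHom 1 (symplecticGroupFinOneEquiv.symm g))
  rw [isZeroAtImInfty_slashSq_iff_tendsto_ray hN hM g]
  have h := (mem_halfLevelCuspSpace_iff.1 hF).2 ξ _ hξ 0 (mem_siegelUpperHalfSpace_zero 0)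
  have h2 : Tendsto (fun t : ℝ => ‖siegelSlashHat (k : ℤ) ξ F (blockDiag1 0 (I * t))‖ ^ 2) atTop (𝓝 0) := by
    simpa using (tendsto_zero_iff_norm_tendsto_zero.1 h).pow 2
  refine tendsto_zero_iff_norm_tendsto_zero.2 (h2.congr' ?_)
  filter_upwards [eventually_gt_atTop (0 : ℝ)] with t ht
  have hIm : 0 < (I * t : ℂ).im := by simp [ht]
  rw [blockDiag1_fin_zero, UpperHalfPlane.ofComplex_apply_of_im_pos hIm, ← norm_siegelSlashHat_one1_sq hξ ⟨I * t, hIm⟩]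

/-- `τ ↦ F((τ))` for `F = (Z ↦ f(Z₀₀))` cut off outside `H_1` is `f` (the bare-function form of A2-277's
`toUHPFun_indicator_ofUHPFun`). [cite: AndrianovZhuravlev2015, Ch. 2 §2.3 (p0064)] -/
theorem toUHPFun_indicator_ofUHPFun_fun (f : ℍ → ℂ) : toUHPFun ((siegelUpperHalfSpace 1).indicator (ofUHPFun f)) = f := by
  funext τ
  rw [toUHPFun_apply, Set.indicator_of_mem (one1_coe_mem τ), ofUHPFun_one1]

/-- **`S → 𝔑`: `f ∈ S_{k/2}(N, χ)` (`4 ∣ N`) ⟹ `(Z ↦ f(Z₀₀))` (cut off outside `H_1`) lies in `𝔑_{k/2}(Γ₀¹(N), [χ])`.** For `ξ ∈ 𝔊`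
over `M ∈ Γ¹`, `M = spOfSL g`: `|(F|_{k/2}ξ)((iλ))|² = |f(g·iλ)²/(c·iλ + d)^k| → 0` since `f(gz)²/(cz + d)^k → 0` at `i∞` (§2, and
the ray tends to `i∞`). [cite: AndrianovZhuravlev2015, Ch. 2 §3.5 (3.67) («ξ = M̂ ∈ 𝔊 with P(M̂) ∈ Γⁿ») (p0079)] [cite: Shimura1973HalfIntegral, §1] -/
theorem indicator_ofUHPFun_mem_halfLevelCuspSpace (hN : 4 ∣ N) (hf : f ∈ halfIntCuspForms k N χ) :
    (siegelUpperHalfSpace 1).indicator (ofUHPFun f) ∈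
      halfLevelCuspSpace (siegelGamma0 1 N) (k : ℤ) (gamma0DirichletChar 1 N χ) := by
  have hf' := halfIntCuspForms_le_halfIntModularForms k N χ hf
  refine mem_halfLevelCuspSpace_iff.2 ⟨indicator_ofUHPFun_mem_halfLevelSpace χ hN hf', fun ξ M hξ Z hZ => ?_⟩
  set g : SL(2, ℤ) := symplecticGroupFinOneEquiv M with hg
  have hM : symplecticGroupFinOneEquiv.symm g = M := by rw [hg, MulEquiv.symm_apply_apply]
  have hξ' : ξ.val = symplecticIntHom 1 (symplecticGroupFinOneEquiv.symm g) := by rw [hM]; exact hξ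
  have hz : Tendsto (slashSq k f g) UpperHalfPlane.atImInfty (𝓝 0) := (mem_halfIntCuspForms_iff.1 hf).2.2 g
  have hray := tendsto_zero_iff_norm_tendsto_zero.1 (hz.comp tendsto_ofComplex_I_mul_atImInfty)
  apply tendsto_zero_of_norm_pow_tendsto_zero (n := 2)
  refine hray.congr' ?_
  filter_upwards [eventually_gt_atTop (0 : ℝ)] with t ht
  have hIm : 0 < (I * t : ℂ).im := by simp [ht]
  have hZ0 : Z = 0 := Subsingleton.elim _ _
  rw [Function.comp_apply, hZ0, blockDiag1_fin_zero, UpperHalfPlane.ofComplex_apply_of_im_pos hIm,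
    norm_siegelSlashHat_one1_sq hξ' ⟨I * t, hIm⟩, toUHPFun_indicator_ofUHPFun_fun]

/-- **(3.67) ⟹ Shimura's cusp condition**: `F ∈ 𝔐_{k/2}(Γ₀¹(N), [χ])` a cusp-form in A–Z's sense (`4 ∣ N`) ⟹ `τ ↦ F((τ))` is a
cusp form `∈ S_{k/2}(N, χ)`. [cite: AndrianovZhuravlev2015, Ch. 2 §3.5 (3.67) (p0079)] [cite: Shimura1973HalfIntegral, §1] -/
theorem IsSiegelCuspFormHalfLevel.toUHPFun_mem_halfIntCuspForms (hN : 4 ∣ N)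
    (hF : IsSiegelCuspFormHalfLevel (siegelGamma0 1 N) (k : ℤ) (gamma0DirichletChar 1 N χ) F) :
    toUHPFun F ∈ halfIntCuspForms k N χ := by
  have h := toUHPFun_mem_halfIntCuspForms_of_mem_halfLevelCuspSpace χ hN
    (hF.indicator_mem_halfLevelCuspSpace (siegelPrincipalGamma_le_siegelGamma0 N) (siegelGamma0_le_of_dvd hN)
      (gamma0DirichletChar_pow_orderOf N χ) (NeZero.pos N) (orderOf_pos χ))
  rwa [toUHPFun_indicator] at h

/-- **Shimura's cusp condition ⟹ (3.67)**: `f ∈ S_{k/2}(N, χ)` (`4 ∣ N`) ⟹ `Z ↦ f(Z₀₀)` is a cusp-form of `𝔐_{k/2}(Γ₀¹(N), [χ])` in A–Z's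
sense (for EVERY `ξ ∈ 𝔊` over `Γ¹`). [cite: AndrianovZhuravlev2015, Ch. 2 §3.5 (3.67) (p0079)] [cite: Shimura1973HalfIntegral, §1] -/
theorem isSiegelCuspFormHalfLevel_ofUHPFun_of_mem (hN : 4 ∣ N) (hf : f ∈ halfIntCuspForms k N χ) :
    IsSiegelCuspFormHalfLevel (siegelGamma0 1 N) (k : ℤ) (gamma0DirichletChar 1 N χ) (ofUHPFun f) := by
  have h := isSiegelCuspFormHalfLevel_of_mem_halfLevelCuspSpace (siegelPrincipalGamma_le_siegelGamma0 N)
    (siegelGamma0_le_of_dvd hN) (gamma0DirichletChar_pow_orderOf N χ) (NeZero.pos N) (orderOf_pos χ)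
    (indicator_ofUHPFun_mem_halfLevelCuspSpace χ hN hf)
  exact h.congr fun Z hZ => Set.indicator_of_mem hZ _

end Cusp

/-! ### §4 `𝔑_{k/2}(Γ₀¹(N), [χ]) ≃ₗ[ℂ] S_{k/2}(N, χ)` -/

section Equiv

variable (k N : ℕ) [NeZero N] (χ : DirichletCharacter ℂ N)

/-- **`𝔑_{k/2}(Γ₀¹(N), [χ]) ≃ₗ[ℂ] S_{k/2}(N, χ)`** (`4 ∣ N`): A–Z's cusp-forms of half-integral weight `k/2` for `Γ₀¹(N)` with the
character `[χ]` ARE Shimura's `S_{k/2}(N, χ)` (`halfIntCuspForms k N χ`) — `F ↦ (τ ↦ F((τ)))`, inverse `f ↦ (Z ↦ f(Z₀₀))` cut off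
outside `H_1` (the restriction of A2-308's `halfLevelSpaceShimuraEquiv`).
[cite: AndrianovZhuravlev2015, Ch. 2 §3.5 (3.67) ("𝔑_w(K, χ) … the subspace of cusp-forms") (p0079)] [cite: Shimura1973HalfIntegral, §1 (S_k(N, χ))] -/
def halfLevelCuspSpaceShimuraEquiv (hN : 4 ∣ N) :
    halfLevelCuspSpace (siegelGamma0 1 N) (k : ℤ) (gamma0DirichletChar 1 N χ) ≃ₗ[ℂ] halfIntCuspForms k N χ where
  toFun F := ⟨toUHPFun (F : Matrix (Fin 1) (Fin 1) ℂ → ℂ), toUHPFun_mem_halfIntCuspForms_of_mem_halfLevelCuspSpace χ hN F.2⟩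
  map_add' F G := Subtype.ext (funext fun _ => rfl)
  map_smul' c F := Subtype.ext (funext fun _ => rfl)
  invFun f := ⟨(siegelUpperHalfSpace 1).indicator (ofUHPFun (f : ℍ → ℂ)), indicator_ofUHPFun_mem_halfLevelCuspSpace χ hN f.2⟩
  left_inv F := by
    apply Subtype.ext
    funext Z
    change (siegelUpperHalfSpace 1).indicator (ofUHPFun (toUHPFun (F : Matrix (Fin 1) (Fin 1) ℂ → ℂ))) Z =
      (F : Matrix (Fin 1) (Fin 1) ℂ → ℂ) Z
    by_cases hZ : Z ∈ siegelUpperHalfSpace 1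
    · rw [Set.indicator_of_mem hZ, ofUHPFun_apply_of_mem _ hZ, toUHPFun_apply, one1_toUHP hZ]
    · rw [Set.indicator_of_notMem hZ, F.2.1.2 Z hZ]
  right_inv f := Subtype.ext (toUHPFun_indicator_ofUHPFun_fun (f : ℍ → ℂ))

variable {k N χ}

/-- The values of `halfLevelCuspSpaceShimuraEquiv k N χ hN F`: `τ ↦ F((τ))`. [cite: AndrianovZhuravlev2015, Ch. 2 §3.5 (p0079)] -/
@[simp] theorem halfLevelCuspSpaceShimuraEquiv_apply (hN : 4 ∣ N)
    (F : halfLevelCuspSpace (siegelGamma0 1 N) (k : ℤ) (gamma0DirichletChar 1 N χ)) (τ : ℍ) :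
    ((halfLevelCuspSpaceShimuraEquiv k N χ hN F : halfIntCuspForms k N χ) : ℍ → ℂ) τ =
      (F : Matrix (Fin 1) (Fin 1) ℂ → ℂ) (one1 (τ : ℂ)) :=
  rfl

/-- The inverse: `f ↦ (Z ↦ f(Z₀₀))` cut off outside `H_1`. [cite: AndrianovZhuravlev2015, Ch. 2 §3.5 (p0079)] -/
theorem coe_halfLevelCuspSpaceShimuraEquiv_symm_apply (hN : 4 ∣ N) (f : halfIntCuspForms k N χ) :
    (((halfLevelCuspSpaceShimuraEquiv k N χ hN).symm f :
        halfLevelCuspSpace (siegelGamma0 1 N) (k : ℤ) (gamma0DirichletChar 1 N χ)) : Matrix (Fin 1) (Fin 1) ℂ → ℂ) =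
      (siegelUpperHalfSpace 1).indicator (ofUHPFun (f : ℍ → ℂ)) :=
  rfl

/-- Compatibility with A2-308: on `𝔑 ⊂ 𝔐` the cusp equivalence is the restriction of `halfLevelSpaceShimuraEquiv` (same
underlying function `τ ↦ F((τ))`). [cite: AndrianovZhuravlev2015, Ch. 2 §3.5 (p0079)] -/
theorem coe_halfLevelCuspSpaceShimuraEquiv_eq (hN : 4 ∣ N)
    (F : halfLevelCuspSpace (siegelGamma0 1 N) (k : ℤ) (gamma0DirichletChar 1 N χ)) :
    ((halfLevelCuspSpaceShimuraEquiv k N χ hN F : halfIntCuspForms k N χ) : ℍ → ℂ) =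
      ((halfLevelSpaceShimuraEquiv k N χ hN ⟨F, halfLevelCuspSpace_le_halfLevelSpace F.2⟩ : halfIntModularForms k N χ) :
        ℍ → ℂ) :=
  rfl

/-- `finrank 𝔑_{k/2}(Γ₀¹(N), [χ]) = finrank S_{k/2}(N, χ)`. [cite: AndrianovZhuravlev2015, Ch. 2 §3.5 (p0079)] [cite: Shimura1973HalfIntegral, §1] -/
theorem finrank_halfLevelCuspSpace_gamma0_one_eq (hN : 4 ∣ N) :
    Module.finrank ℂ (halfLevelCuspSpace (siegelGamma0 1 N) (k : ℤ) (gamma0DirichletChar 1 N χ)) =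
      Module.finrank ℂ (halfIntCuspForms k N χ) :=
  (halfLevelCuspSpaceShimuraEquiv k N χ hN).finrank_eq

end Equiv

end SiegelModularForm

end Literature.NumberTheory.ModularForms
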